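import Summits.ResolutionOfSingularities.ResolutionOfSingularities.Theorems.FrobeniusClosingSteerHeartDenseCore
import Summits.ResolutionOfSingularities.ResolutionOfSingularities.Theorems.FrobeniusClosingSteerShannonCoarseningLemmas
import Summits.ResolutionOfSingularities.ResolutionOfSingularities.Theorems.FrobeniusClosingSteerMembersPerfectResidue
import Summits.ResolutionOfSingularities.ResolutionOfSingularities.Theorems.FrobeniusClosingSteerMonomialStageTrichotomy
import Summits.ResolutionOfSingularities.ResolutionOfSingularities.Theorems.FrobeniusClosingSteerCore4SteeredRunExists
import Summits.ResolutionOfSingularities.ResolutionOfSingularities.Theorems.FrobeniusClosingSteerSwitchingAssembly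
import HarnessLib

/-!
# Crux `Steer` (stmt-ResolutionOfSingularities-16345), line `switching_dichotomy`, card `singular-trace-constructor`:
# a `Concl`-witness in the (α) heart has NON-REGULAR downstairs trace — modulo Kunz's conjecture (Kimura–Niitsuma 1982)
# in its degree-`p`, equal-residue-field form

OURS (campaign `res-hironaka`, rung L ★L-G4, slot W4.1, chain W4.1; seat `res-type-083` g8 on res-L0-w41-plan-1's RULING 98
(2026-08-27T10:58:48Z, «DEAL: strat-1's MODEL-SHAPE LEMMA»); statement, the three `Prop`s and the six-step plan VERBATIM from the
crux strategist res-L0-w41-strat-1 g5's `L/res-L0-w41-strat-1/Sketch-g5-SingularTrace.lean` sha16 3f1265751b28c143 (card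
`idea-singular-trace.md`); Theses-free helper `--supports stmt-ResolutionOfSingularities-16345`; replaces the role of no printed item;
NOT a statement of the manuscript under review [claim: Hironaka2017, status: under-review]; AI-produced, weaker than expert review).

* `KunzKimuraNiitsumaDegP p K` — HYPOTHESIS `Prop` (RULING 69 / RULING 98 words guard: E-8 style, consumed only as a binder `hKN`;
  NO `Literature/` file this wave): Kunz's conjecture in the form proved by Kimura–Niitsuma, specialised to field degree `p` and equal
  residue fields, IN SITU for two regular local subrings `R ≤ S` of a field `K` [corpus: paper:kimura1982-kunz-s-conjecture p5 Theorem (§3),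
  p2 Lemma 1; folklore reading of the one-element `p`-basis: `S = R[z]`, `z ^ p` a regular parameter of `R`].
* `NoExitModel' p O A₀ t` — verbatim copy of the skeleton's `NoExitModel` (r34 l.5023; the skeleton is not importable).
* `TraceNotRegular p` — the card's FIRST LEMMA: under a core datum and `NoExitModel`, a `Concl`-witness `A` (f.g., `A₀ ≤ A ∋ t`, regular
  at the centre of `O`) has a non-regular TRACE `A''` (`locAtCentre A'' O = locAtCentre A O ∩ Frac A₀`).
* `traceNotRegular_of_kunz` — **PROVED here**: `(∀ K, KunzKimuraNiitsumaDegP p K) → TraceNotRegular p`, by strat-1's plan: with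
  `S := locAtCentre A O`, `R := locAtCentre A'' O` — (1) `R ≤ S`, both local (`isLocalRing_locAtCentre`) and regular
  (`isRegularLocalRing_locAtCentre_iff`); (2) `S ^ p ⊆ R` (`Shannon.exists_pow_eq_div`: `K ^ p ⊆ Frac A₀`); (3) `S ≤ closure (R ∪ G)`,
  `G` the generators of `A` (`x = y/z = (y·z^{p-1})·(z^p)⁻¹`, `inv_mem_locAtCentre`); (4) equal residue fields
  (`MembersPerfectResidue.perfectField_residueField` + `MonomialStage.exists_isUnit_sub_pow_mem_maximalIdeal` on `R`, read through the
  valuation); (5) the degree clause with `t₀ := t` (every element of `K = Frac A₀[t]` is a polynomial in `t` with coefficients `a / b`,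
  `a, b ∈ A₀ ⊆ R` — `exists_polynomial_of_mem_adjoin`); (6) `t ∉ R` (`SteeredRun.not_mem_closure_of_ne_pow`); the fact then gives `z`
  with `GenAt R p t z` and `OrderOneGen R p z` (`g := 0`), i.e. `ExitAt R p t` — forbidden by `NoExitModel'` at `A''`. [folklore]
-/

-- `Summit.<S>.<S>.…` duplicates the summit name by design (single-problem summit).
set_option linter.dupNamespace false

open IsLocalRing
open Literature.AlgebraicGeometry.Resolution
open Summit.ResolutionOfSingularities.ResolutionOfSingularities.Theorems.SteerRankThinness
open Summit.ResolutionOfSingularities.ResolutionOfSingularities.Theorems.SwitchingDichotomy.Words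

namespace Summit.ResolutionOfSingularities.ResolutionOfSingularities.Theorems.SwitchingDichotomy

namespace SingularTrace

variable {k K : Type} [Field k] [Field K] [Algebra k K]

/-- **Kunz's conjecture, degree `p`, equal residue fields, in situ** (Kimura–Niitsuma 1982, Theorem §3 + Lemma 1; folklore
reading of the one-element `p`-basis) — HYPOTHESIS `Prop`, consumed only as a binder (res-L0-w41-plan-1 RULING 69/98 words guard;
VERBATIM from res-L0-w41-strat-1's `Sketch-g5-SingularTrace.lean` 3f1265751b28c143). `R ≤ S` regular local subrings of `K`,
`S ^ p ⊆ R`, `S` finitely generated over `R`, `κ_S = κ_R` (every `s` is congruent to some `r ∈ R` modulo the non-units of `S`),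
`Frac S ⊆ (Frac R)(t₀)` for one `t₀ ∈ S` with `t₀ ^ p ∈ R`, and `S ≠ R`. Then `S = R[z]` for some `z ∈ S` whose `p`-th power is a
regular parameter of `R`. OURS transcription; not asserted. [cite: KimuraNiitsuma1982, Theorem §3; Lemma 1] [folklore] -/
def KunzKimuraNiitsumaDegP (p : ℕ) (K : Type) [Field K] : Prop :=
  ∀ (R S : Subring K) [IsLocalRing R] [IsLocalRing S], R ≤ S →
    IsRegularLocalRing R → IsRegularLocalRing S →
    (∀ s ∈ S, s ^ p ∈ R) →
    (∃ G : Finset K, (↑G : Set K) ⊆ S ∧ S ≤ Subring.closure ((R : Set K) ∪ ↑G)) →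
    (∀ s ∈ S, ∃ r ∈ R, ∀ y ∈ S, (s - r) * y ≠ 1) →
    (∃ t₀ ∈ S, t₀ ^ p ∈ R ∧ ∀ s ∈ S, ∃ q : Polynomial K,
      (∀ i, ∃ a ∈ R, ∃ b ∈ R, b ≠ 0 ∧ q.coeff i = a / b) ∧ s = q.eval t₀) →
    (∃ s ∈ S, s ∉ R) →
    ∃ z ∈ S, z ^ p ∈ R ∧ S ≤ Subring.closure (insert z (R : Set K)) ∧
      ∃ w : Fin 1 → R, IsRsopPart w ∧ ((w 0 : R) : K) = z ^ p

/-- Verbatim copy of the skeleton's `NoExitModel` (`Cruxes/Steer/Lines/switching_dichotomy.lean` r34 l.5023; not a tree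
declaration, the skeleton carries `sorry`): every finitely generated `A₁ ⊇ A₀` inside `O`, regular at the centre, has NO exit stage
of the `α_p`-torsor of `t` over `locAtCentre A₁ O`. OURS. [folklore] -/
def NoExitModel' (p : ℕ) (O : ValuationSubring K) (A₀ : Subalgebra k K) (t : K) : Prop :=
  ∀ (A₁ : Subalgebra k K) (h₁ : A₁.toSubring ≤ O.toSubring), A₀ ≤ A₁ → A₁.FG →
    IsRegularLocalRing (Localization.AtPrime
      (Ideal.comap (Subring.inclusion h₁) (IsLocalRing.maximalIdeal O))) →
    ¬ ExitAt (locAtCentre A₁.toSubring O) p t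

/-- **Card `singular-trace-constructor`, FIRST LEMMA** (res-L0-w41-strat-1 g5, verbatim). Under a core datum and `NoExitModel`,
every `Concl`-witness `A` (f.g., `A₀ ≤ A ∋ t`, regular at the centre of `O`) has a NON-regular trace: if `A'' ⊇ A₀` is f.g. inside `O`
and its centre ring is the trace `locAtCentre A O ∩ Frac A₀`, then `A''` is not regular at the centre. OURS. [folklore] -/
def TraceNotRegular (p : ℕ) : Prop :=
  ∀ (n : ℕ) (k K : Type) [Field k] [CharP k p] [PerfectField k] [Field K] [Algebra k K]
    (O : ValuationSubring K) (A₀ : Subalgebra k K) (h₀ : A₀.toSubring ≤ O.toSubring) (t : K),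
    CoreDatum p n k K O A₀ h₀ t → NoExitModel' p O A₀ t →
    ∀ (A : Subalgebra k K) (h : A.toSubring ≤ O.toSubring), A₀ ≤ A → t ∈ A → A.FG →
      IsRegularLocalRing (Localization.AtPrime (Ideal.comap (Subring.inclusion h) (maximalIdeal O))) →
      ∀ (A'' : Subalgebra k K) (h'' : A''.toSubring ≤ O.toSubring), A₀ ≤ A'' → A''.FG →
        (∀ x : K, x ∈ locAtCentre A''.toSubring O ↔ (x ∈ locAtCentre A.toSubring O ∧ IsFracOf A₀ x)) →
        ¬ IsRegularLocalRing (Localization.AtPrime (Ideal.comap (Subring.inclusion h'') (maximalIdeal O)))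

/-! ## Step (5) of the plan: elements of `A₀[t]` are polynomials in `t` with coefficients in `A₀` -/

/-- Every element of `A₀[t] = Algebra.adjoin k (insert t A₀)` is `q.eval t` for a polynomial `q` over `K` with ALL coefficients in
`A₀`. [folklore] -/
theorem exists_polynomial_of_mem_adjoin (A₀ : Subalgebra k K) (t : K) {x : K}
    (hx : x ∈ Algebra.adjoin k (insert t (A₀ : Set K))) :
    ∃ q : Polynomial K, (∀ i, q.coeff i ∈ A₀) ∧ q.eval t = x := by
  induction hx using Algebra.adjoin_induction with
  | mem x hx =>
    rcases Set.mem_insert_iff.mp hx with rfl | hx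
    · refine ⟨Polynomial.X, fun i => ?_, Polynomial.eval_X⟩
      rw [Polynomial.coeff_X]
      split_ifs
      · exact A₀.one_mem
      · exact A₀.zero_mem
    · refine ⟨Polynomial.C x, fun i => ?_, Polynomial.eval_C⟩
      rw [Polynomial.coeff_C]
      split_ifs
      · exact hx
      · exact A₀.zero_mem
  | algebraMap r =>
    refine ⟨Polynomial.C (algebraMap k K r), fun i => ?_, Polynomial.eval_C⟩
    rw [Polynomial.coeff_C]
    split_ifs
    · exact A₀.algebraMap_mem r
    · exact A₀.zero_mem
  | add x y _ _ hx hy =>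
    obtain ⟨q₁, hq₁, rfl⟩ := hx
    obtain ⟨q₂, hq₂, rfl⟩ := hy
    exact ⟨q₁ + q₂, fun i => by rw [Polynomial.coeff_add]; exact A₀.add_mem (hq₁ i) (hq₂ i),
      Polynomial.eval_add⟩
  | mul x y _ _ hx hy =>
    obtain ⟨q₁, hq₁, rfl⟩ := hx
    obtain ⟨q₂, hq₂, rfl⟩ := hy
    refine ⟨q₁ * q₂, fun i => ?_, Polynomial.eval_mul⟩
    rw [Polynomial.coeff_mul]
    exact sum_mem fun j _ => A₀.mul_mem (hq₁ _) (hq₂ _)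

/-- `z ^ p = z ^ (p - 1) * z` for `p ≥ 1`. [folklore] -/
theorem pow_eq_pow_pred_mul {p : ℕ} (hp : 1 ≤ p) (z : K) : z ^ p = z ^ (p - 1) * z := by
  rw [← pow_succ, Nat.sub_add_cancel hp]

/-- The generators of a finitely generated `k`-subalgebra `A` generate it, as a RING, over any subring containing the image of `k`.
[folklore] -/
theorem adjoin_le_closure_union {G : Finset K} {A : Subalgebra k K} (hG : Algebra.adjoin k (↑G : Set K) = A) (R : Subring K)
    (hkR : ∀ c : k, algebraMap k K c ∈ R) {x : K} (hx : x ∈ A) : x ∈ Subring.closure ((R : Set K) ∪ ↑G) := by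
  rw [← hG] at hx
  induction hx using Algebra.adjoin_induction with
  | mem x hx => exact Subring.subset_closure (Or.inr hx)
  | algebraMap r => exact Subring.subset_closure (Or.inl (hkR r))
  | add x y _ _ hx hy => exact Subring.add_mem _ hx hy
  | mul x y _ _ hx hy => exact Subring.mul_mem _ hx hy

/-! ## The composition -/

/-- **`(∀ K, KunzKimuraNiitsumaDegP p K) → TraceNotRegular p`** (res-L0-w41-strat-1 g5's six-step plan, kernel-checked). With
`S := locAtCentre A O` and `R := locAtCentre A'' O`: (1) `R ≤ S` by the trace clause; both local (`isLocalRing_locAtCentre`) and regular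
(`isRegularLocalRing_locAtCentre_iff`); (2) `S ^ p ⊆ R`: every `x : K` has `x ^ p ∈ Frac A₀` (`Shannon.exists_pow_eq_div`) and `S` is
closed under powers; (3) `S ≤ closure (R ∪ G)`, `G` = generators of `A` (`y / z = (y·z^{p-1})·(z^p)⁻¹`, `(z^p)⁻¹ ∈ R` by
`inv_mem_locAtCentre`); (4) equal residue fields: a non-unit `s` is congruent to `0`, a unit `s` has `s ^ p ≡ c ^ p` for a unit `c ∈ R`
(`MembersPerfectResidue.perfectField_residueField`, `MonomialStage.exists_isUnit_sub_pow_mem_maximalIdeal`), and `(s − c)^p = s^p − c^p`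
has value `< 1`; (5) degree clause with `t₀ := t` (`IsFractionRing.div_surjective` + `exists_polynomial_of_mem_adjoin`, denominator `b ^ p ∈
A₀`); (6) `t ∉ R` (`SteeredRun.not_mem_closure_of_ne_pow`: `t ∉ Frac A₀`); the fact's `z` gives `GenAt R p t z` and `OrderOneGen R p z`
(`g := 0`), i.e. `ExitAt R p t`, contradicting `NoExitModel'` at `A''`. OURS. [folklore] -/
theorem traceNotRegular_of_kunz (p : ℕ) (hp : p.Prime) (hKN : ∀ (K : Type) [Field K], KunzKimuraNiitsumaDegP p K) :
    TraceNotRegular p := by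
  intro n k K _ _ _ _ _ O A₀ h₀ t core hneM A h hA₀A htA hfgA hregA A'' h'' hA₀A'' hfgA'' htrace hregA''
  classical
  haveI : Fact p.Prime := ⟨hp⟩
  haveI : CharP K p := charP_of_injective_algebraMap (algebraMap k K).injective p
  obtain ⟨-, htp, hfr, hreg₀, -, hzd, -, -, -, -, -, hc, -, -⟩ := core
  -- the two local rings `R ≤ S` inside `K`
  haveI instS : IsLocalRing (locAtCentre A.toSubring O) := isLocalRing_locAtCentre h
  haveI instR : IsLocalRing (locAtCentre A''.toSubring O) := isLocalRing_locAtCentre h''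
  have hregS : IsRegularLocalRing (locAtCentre A.toSubring O) := (isRegularLocalRing_locAtCentre_iff h).mpr hregA
  have hregR : IsRegularLocalRing (locAtCentre A''.toSubring O) := (isRegularLocalRing_locAtCentre_iff h'').mpr hregA''
  have hSO : locAtCentre A.toSubring O ≤ O.toSubring := locAtCentre_le h
  have hRO : locAtCentre A''.toSubring O ≤ O.toSubring := locAtCentre_le h''
  -- (1) `R ≤ S`
  have hRS : locAtCentre A''.toSubring O ≤ locAtCentre A.toSubring O := fun x hx => ((htrace x).mp hx).1
  -- `k ⊆ A₀ ⊆ R`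
  have hA₀R : ∀ x ∈ A₀, x ∈ locAtCentre A''.toSubring O :=
    fun x hx => le_locAtCentre A''.toSubring O (hA₀A'' hx)
  have hkR : ∀ c : k, algebraMap k K c ∈ locAtCentre A''.toSubring O := fun c => hA₀R _ (A₀.algebraMap_mem c)
  -- (2) `S ^ p ⊆ R`
  have hSp : ∀ s ∈ locAtCentre A.toSubring O, s ^ p ∈ locAtCentre A''.toSubring O := fun s hs =>
    (htrace (s ^ p)).mpr ⟨Subring.pow_mem _ hs p, Shannon.exists_pow_eq_div p A₀ t htp hfr s⟩
  -- (3) finite generation over `R`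
  have hFG : ∃ G : Finset K, (↑G : Set K) ⊆ locAtCentre A.toSubring O ∧
      locAtCentre A.toSubring O ≤ Subring.closure ((locAtCentre A''.toSubring O : Set K) ∪ ↑G) := by
    obtain ⟨G, hG⟩ := hfgA
    refine ⟨G, fun x hx => le_locAtCentre A.toSubring O ?_, fun x hx => ?_⟩
    · change x ∈ A
      rw [← hG]
      exact Algebra.subset_adjoin hx
    · obtain ⟨y, hy, z, hz, hvz, rfl⟩ := hx
      have hz0 : z ≠ 0 := ne_zero_of_valuation_eq_one hvz
      have hzS : z ∈ locAtCentre A.toSubring O := le_locAtCentre A.toSubring O hz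
      have hzpR : z ^ p ∈ locAtCentre A''.toSubring O := hSp z hzS
      have hzpinv : (z ^ p)⁻¹ ∈ locAtCentre A''.toSubring O :=
        inv_mem_locAtCentre hzpR (by rw [map_pow, hvz, one_pow])
      have hyz : y * z ^ (p - 1) ∈ Subring.closure ((locAtCentre A''.toSubring O : Set K) ∪ ↑G) :=
        adjoin_le_closure_union hG _ hkR (A.mul_mem hy (A.pow_mem hz _))
      have hrew : y / z = y * z ^ (p - 1) * (z ^ p)⁻¹ := by
        rw [pow_eq_pow_pred_mul hp.one_le z]
        field_simp
      rw [hrew]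
      exact Subring.mul_mem _ hyz (Subring.subset_closure (Or.inl hzpinv))
  -- (4) equal residue fields
  haveI : PerfectField (ResidueField (locAtCentre A''.toSubring O)) :=
    MembersPerfectResidue.perfectField_residueField O (locAtCentre A''.toSubring O) hRO hkR hzd
  have hres : ∀ s ∈ locAtCentre A.toSubring O, ∃ r ∈ locAtCentre A''.toSubring O,
      ∀ y ∈ locAtCentre A.toSubring O, (s - r) * y ≠ 1 := by
    intro s hs
    -- a non-unit is congruent to `0`; a unit has a unit `c ∈ R` with `v (s - c) < 1`
    have key : ∃ r ∈ locAtCentre A''.toSubring O, O.valuation (s - r) < 1 := by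
      by_cases hvs : O.valuation s < 1
      · exact ⟨0, Subring.zero_mem _, by rwa [sub_zero]⟩
      have hvs1 : O.valuation s = 1 := le_antisymm ((O.valuation_le_one_iff _).mpr (hSO hs)) (not_lt.mp hvs)
      have hspR : s ^ p ∈ locAtCentre A''.toSubring O := hSp s hs
      have hu : IsUnit (⟨s ^ p, hspR⟩ : locAtCentre A''.toSubring O) := by
        by_contra hnu
        have hlt : O.valuation (s ^ p) < 1 := (not_isUnit_locAtCentre_iff h'' ⟨s ^ p, hspR⟩).mp hnu
        rw [map_pow, hvs1, one_pow] at hlt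
        exact lt_irrefl _ hlt
      obtain ⟨c, -, hc⟩ := MonomialStage.exists_isUnit_sub_pow_mem_maximalIdeal (S := locAtCentre A''.toSubring O) p hu
      have hlt : O.valuation (s ^ p - (c : K) ^ p) < 1 := by
        have h1 := (mem_maximalIdeal_locAtCentre_iff h'' _).mp hc
        simpa using h1
      rw [← sub_pow_char s (c : K), map_pow] at hlt
      refine ⟨(c : K), c.2, ?_⟩
      by_contra hge
      exact absurd hlt (not_lt.mpr (one_le_pow₀ (not_lt.mp hge)))
    obtain ⟨r, hr, hvr⟩ := key
    refine ⟨r, hr, fun y hy hy1 => ?_⟩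
    have hvy : O.valuation y ≤ 1 := (O.valuation_le_one_iff _).mpr (hSO hy)
    have hlt : O.valuation ((s - r) * y) < 1 := by
      rw [map_mul]
      calc O.valuation (s - r) * O.valuation y ≤ O.valuation (s - r) * 1 := by gcongr
        _ < 1 := by rw [mul_one]; exact hvr
    rw [hy1, map_one] at hlt
    exact lt_irrefl _ hlt
  -- (5) the degree clause with `t₀ := t`
  have htS : t ∈ locAtCentre A.toSubring O := le_locAtCentre A.toSubring O htA
  have htpR : t ^ p ∈ locAtCentre A''.toSubring O := hA₀R _ htp
  have hdeg : ∃ t₀ ∈ locAtCentre A.toSubring O, t₀ ^ p ∈ locAtCentre A''.toSubring O ∧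
      ∀ s ∈ locAtCentre A.toSubring O, ∃ q : Polynomial K,
        (∀ i, ∃ a ∈ locAtCentre A''.toSubring O, ∃ b ∈ locAtCentre A''.toSubring O, b ≠ 0 ∧ q.coeff i = a / b) ∧
        s = q.eval t₀ := by
    refine ⟨t, htS, htpR, fun s _ => ?_⟩
    haveI := hfr
    obtain ⟨a, b, hb, rfl⟩ := IsFractionRing.div_surjective (A := Algebra.adjoin k (insert t (A₀ : Set K))) s
    have hb0 : (b : K) ≠ 0 := by
      have : (b : Algebra.adjoin k (insert t (A₀ : Set K))) ≠ 0 := nonZeroDivisors.ne_zero hb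
      exact fun h => this (Subtype.ext h)
    have hab : (a : K) * (b : K) ^ (p - 1) ∈ Algebra.adjoin k (insert t (A₀ : Set K)) :=
      Subalgebra.mul_mem _ a.2 (Subalgebra.pow_mem _ b.2 _)
    obtain ⟨q, hq, hqt⟩ := exists_polynomial_of_mem_adjoin A₀ t hab
    have hbp : (b : K) ^ p ∈ A₀ := Shannon.pow_mem_of_mem_adjoin_insert p A₀ htp b.2
    have hbp0 : (b : K) ^ p ≠ 0 := pow_ne_zero _ hb0
    refine ⟨Polynomial.C ((b : K) ^ p)⁻¹ * q, fun i => ⟨q.coeff i, hA₀R _ (hq i), (b : K) ^ p, hA₀R _ hbp, hbp0, ?_⟩, ?_⟩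
    · rw [Polynomial.coeff_C_mul, div_eq_mul_inv, mul_comm]
    · change (a : K) / (b : K) = _
      rw [Polynomial.eval_mul, Polynomial.eval_C, hqt, pow_eq_pow_pred_mul hp.one_le (b : K)]
      field_simp
  -- (6) `t ∈ S ∖ R`
  have hne : ∃ s ∈ locAtCentre A.toSubring O, s ∉ locAtCentre A''.toSubring O := by
    refine ⟨t, htS, fun htR => ?_⟩
    have hfrac : IsFracOf A₀ t := ((htrace t).mp htR).2
    exact SteeredRun.not_mem_closure_of_ne_pow O A₀ h₀ hp.ne_zero t htp hreg₀ hc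
      ((exists_div_iff_mem_closure A₀ t).mp hfrac)
  -- the fact: a monogenic presentation `S = R[z]` with `z ^ p` a regular parameter of `R` — an EXIT at `R`
  obtain ⟨z, -, hzpR, hSle, w, hw, hwz⟩ :=
    hKN K (locAtCentre A''.toSubring O) (locAtCentre A.toSubring O) hRS hregR hregS hSp hFG hres hdeg hne
  refine hneM A'' h'' hA₀A'' hfgA'' hregA'' ⟨z, ⟨hzpR, hSle htS⟩, 0, Subring.zero_mem _, instR, w, hw, ?_⟩
  rw [hwz, zero_pow hp.ne_zero, sub_zero]

end SingularTrace

end Summit.ResolutionOfSingularities.ResolutionOfSingularities.Theorems.SwitchingDichotomy
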